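import Literature.IUT.HodgeArakelov.GaussianMonoidsGood
import HarnessLib

/-!
# [IUTchII] Cor 4.5 (iii) / Cor 4.6 (iii): symmetrizing isomorphisms, the diagonal submonoids they
# determine, and the identification `Ψ_cns(†D_≻)_0 ⥲ Ψ_cns(†D_≻)_{⟨F_l^⋇⟩}` — typed intermediate of
# SUB-DAGs `plan/L6/SUBDAG-IUTchII-Cor-45.md` (rows Cor-45.iii.r8, r10, r11; W6-S9-a, abc-iut-w5-d118) and
# `plan/L6/SUBDAG-IUTchII-Cor-46.md` (rows Cor-46.iii.r9, r10; W6-S9-b, abc-iut-w5-d100), and of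
# SUBDAG-IUTchIII-Thm-15 row r6a (abc-iut cell, D-0068 (1) statements-first)

S. Mochizuki, *Inter-universal Teichmüller theory II*, kurims Dec-2020 manuscript (render
`paper:url-5036b4059555`), Corollary 4.5 (iii) p. 132 l. 38 – p. 133 l. 10 and Corollary 4.6 (iii)
p. 138 l. 24–47 [cite: Mochizuki2012, Cor 4.5 (iii) p.132]. Claim key DISPUTED (D-0012): this file is a
piece of elementary monoid bookkeeping; nothing of [IUTchII] is asserted.

**What is printed** (p. 132 l. 48 – p. 133 l. 10, own render): "the various local `F_l^⋊±`-actions …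
induce isomorphisms between the labeled data `Ψ_cns(†D_≻)_t` for distinct `t ∈ LabCusp^±(†D_≻)`. We shall
refer to these isomorphisms as [`F_l^⋊±`-]symmetrizing isomorphisms. These symmetrizing isomorphisms …
determine diagonal submonoids `Ψ_cns(†D_≻)_{⟨|F_l|⟩} ⊆ ∏_{|t| ∈ |F_l|} Ψ_cns(†D_≻)_{|t|}`;
`Ψ_cns(†D_≻)_{⟨F_l^⋇⟩} ⊆ ∏_{|t| ∈ F_l^⋇} Ψ_cns(†D_≻)_{|t|}` — where the «⊆'s» denote the various local
inclusions of diagonal submonoids of Corollary 3.5, (i), and Propositions 4.1, (iii); 4.3, (iii) — as well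
as an isomorphism `Ψ_cns(†D_≻)_0 ⥲ Ψ_cns(†D_≻)_{⟨F_l^⋇⟩}` constituted by the various corresponding local
isomorphisms of Corollary 3.5, (iii), and Propositions 4.1, (iii); 4.3, (iii)."  Cor 4.6 (iii) p. 138
l. 40–47 prints the same shape for `Ψ_cns(†F_≻)_t`.

**What the tree had.** The LOCAL kernel at one place is abc-iut-L6-t2's `diagonalSubmonoid T M`
(constant families of LITERAL copies of one monoid `M`, the symmetrizing isomorphisms being identities) with
`diagonalIso : M ≃* diagonalSubmonoid T M` (`GaussianMonoidsGood.lean`, Prop 4.1 (iii)); the GLOBAL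
statement of Cor 4.5 (iii) / 4.6 (iii) was a Prop SLOT (`Cor45Statements.symmetrizing`,
`Cor46Statements.symmetrizing`, `GlobalGaussianFrobenioids.lean`) and SUBDAG-IUTchIII-Thm-15 row r6a
records the identification `Ψ_cns(‡D)_0 ⥲ Ψ_cns(‡D)_{⟨F_l^⋇⟩}` as "untyped on the [IUTchII] side" (consumer
slot `Literature.IUT.LogThetaLattice.BiCoricData.fxOfDsucc`).

**What this file types (and proves — it is bookkeeping).** The monoid-level content of the two displays for
an ARBITRARY family of labeled monoids `Ψ_t` (`t ∈ T`) equipped with a compatible system of symmetrizing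
isomorphisms `σ_{t,t'} : Ψ_t ⥲ Ψ_{t'}` (`SymmetrizingIsos`: `σ_{t,t} = id`, `σ_{t',t''} ∘ σ_{t,t'} = σ_{t,t''}`
— this compatibility is what "conjugate synchronization" buys, Rmk 4.5.3 (i)): for any re-indexing
`e : S → T` of a set of labels (`|F_l| → LabCusp^±`, `F_l^⋇ ↪ |F_l|`, chosen representatives) the
**diagonal submonoid** `diagonal σ e ⊆ ∏_{s ∈ S} Ψ_{e s}` (`= {x | σ (x s) = x s'}`), the homomorphism
`toDiagonal σ e t₀ : Ψ_{t₀} → ∏_s Ψ_{e s}`, `m ↦ (σ_{t₀, e s} m)_s`, landing in the diagonal, and — for `S`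
nonempty — the **identification** `diagonalIso σ e t₀ : Ψ_{t₀} ≃* diagonal σ e` ("`Ψ_0 ⥲ Ψ_{⟨F_l^⋇⟩}`": NB the
label `t₀ = 0` need NOT belong to the index set `F_l^⋇`), with its evaluation formula; the literal-copies
system `ofCopies` recovers `diagonalSubmonoid` (`diagonal_ofCopies`), and the `V`-indexed product of local
systems (`pi`) has as diagonal exactly the families that are diagonal at every `v` (`mem_diagonal_pi_iff`) —
the printed "«⊆'s» denote the various local inclusions … isomorphism constituted by the various
corresponding local isomorphisms"; and (v2, append-only) the passage from a synchronized transitive ACTION on the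
labels to the system of symmetrizing isomorphisms (`ActionTransport`, `ActionTransport.act_eq_act`,
`ActionTransport.toSymmetrizingIsos`) — "the various local `F_l^⋊±`-actions … induce isomorphisms between the
labeled data" (Cor 4.5 (iii)) with well-definedness supplied by conjugate synchronization (Rmk 4.5.3 (i)).
No instances, no notation, no Prop facts.
-/

namespace Literature.IUT.HodgeArakelov

universe u v w u'

/-- A **system of symmetrizing isomorphisms** between labeled monoids `Ψ_t`, `t ∈ T` ([IUTchII]
Cor 4.5 (iii) p. 132: "isomorphisms between the labeled data `Ψ_cns(†D_≻)_t` for distinct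
`t ∈ LabCusp^±(†D_≻)` … [`F_l^⋊±`-]symmetrizing isomorphisms"; Cor 4.6 (iii) p. 138; locally Cor 3.5 (i),
Props 4.1 (iii), 4.3 (iii)): one isomorphism for each ordered pair of labels, the identity on a single
label, and closed under composition (the well-definedness that conjugate synchronization provides,
Rmk 4.5.3 (i) p. 135). [cite: Mochizuki2012, Cor 4.5 (iii) p.132] -/
structure SymmetrizingIsos {T : Type u} (Ψ : T → Type v) [∀ t, CommMonoid (Ψ t)] where
  /-- the symmetrizing isomorphism `Ψ_t ⥲ Ψ_{t'}` -/
  iso : ∀ t t' : T, Ψ t ≃* Ψ t'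
  /-- on one label it is the identity -/
  iso_self : ∀ (t : T) (x : Ψ t), iso t t x = x
  /-- compatibility under composition -/
  iso_trans : ∀ (t t' t'' : T) (x : Ψ t), iso t' t'' (iso t t' x) = iso t t'' x

namespace SymmetrizingIsos

variable {T : Type u} {Ψ : T → Type v} [∀ t, CommMonoid (Ψ t)] (σ : SymmetrizingIsos Ψ)

/-- The inverse of a symmetrizing isomorphism is the symmetrizing isomorphism in the opposite
direction. [cite: Mochizuki2012, Cor 4.5 (iii) p.132] -/
theorem iso_symm_apply (t t' : T) (y : Ψ t') : (σ.iso t t').symm y = σ.iso t' t y := by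
  apply (σ.iso t t').injective
  rw [MulEquiv.apply_symm_apply, σ.iso_trans, σ.iso_self]

/-- The **diagonal submonoid** `Ψ_{⟨S⟩} ⊆ ∏_{s ∈ S} Ψ_{e(s)}` determined by the symmetrizing isomorphisms,
for a (re-)indexing `e : S → T` of labels — [IUTchII] Cor 4.5 (iii) p. 132–133:
"determine diagonal submonoids `Ψ_cns(†D_≻)_{⟨|F_l|⟩} ⊆ ∏_{|t| ∈ |F_l|} Ψ_cns(†D_≻)_{|t|}`;
`Ψ_cns(†D_≻)_{⟨F_l^⋇⟩} ⊆ ∏_{|t| ∈ F_l^⋇} Ψ_cns(†D_≻)_{|t|}`" (take `e` = representatives of `|F_l|`, resp. of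
`F_l^⋇`, in `LabCusp^±(†D_≻)`); Cor 4.6 (iii) p. 138. [cite: Mochizuki2012, Cor 4.5 (iii) p.133] -/
def diagonal {S : Type w} (e : S → T) : Submonoid (∀ s : S, Ψ (e s)) where
  carrier := {x | ∀ s s' : S, σ.iso (e s) (e s') (x s) = x s'}
  one_mem' := fun s s' => by rw [Pi.one_apply, Pi.one_apply, map_one]
  mul_mem' := fun {a b} ha hb s s' => by rw [Pi.mul_apply, Pi.mul_apply, map_mul, ha s s', hb s s']

/-- Membership in the diagonal submonoid. [cite: Mochizuki2012, Cor 4.5 (iii) p.133] -/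
theorem mem_diagonal_iff {S : Type w} (e : S → T) (x : ∀ s : S, Ψ (e s)) :
    x ∈ σ.diagonal e ↔ ∀ s s' : S, σ.iso (e s) (e s') (x s) = x s' := Iff.rfl

/-- The map `Ψ_{t₀} → ∏_{s ∈ S} Ψ_{e(s)}`, `m ↦ (σ_{t₀,e(s)}(m))_s`, transporting the copy with label `t₀` to
every label of `S` — the map underlying "`Ψ_cns(†D_≻)_0 ⥲ Ψ_cns(†D_≻)_{⟨F_l^⋇⟩}`" (Cor 4.5 (iii) p. 133 l. 3–10;
the label `0 ∉ F_l^⋇`). [cite: Mochizuki2012, Cor 4.5 (iii) p.133] -/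
def toDiagonal {S : Type w} (e : S → T) (t₀ : T) : Ψ t₀ →* ∀ s : S, Ψ (e s) where
  toFun m := fun s => σ.iso t₀ (e s) m
  map_one' := funext fun s => map_one (σ.iso t₀ (e s))
  map_mul' a b := funext fun s => map_mul (σ.iso t₀ (e s)) a b

/-- Evaluation of `toDiagonal`. [cite: Mochizuki2012, Cor 4.5 (iii) p.133] -/
@[simp] theorem toDiagonal_apply {S : Type w} (e : S → T) (t₀ : T) (m : Ψ t₀) (s : S) :
    σ.toDiagonal e t₀ m s = σ.iso t₀ (e s) m := rfl

/-- `toDiagonal` lands in the diagonal submonoid. [cite: Mochizuki2012, Cor 4.5 (iii) p.133] -/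
theorem toDiagonal_mem {S : Type w} (e : S → T) (t₀ : T) (m : Ψ t₀) :
    σ.toDiagonal e t₀ m ∈ σ.diagonal e :=
  fun s s' => by rw [toDiagonal_apply, toDiagonal_apply, σ.iso_trans]

/-- A diagonal family is the transport of any one of its components: `x = toDiagonal (σ⁻¹ (x s₀))`.
[cite: Mochizuki2012, Cor 4.5 (iii) p.133] -/
theorem eq_toDiagonal_of_mem {S : Type w} (e : S → T) (t₀ : T) (s₀ : S) {x : ∀ s : S, Ψ (e s)}
    (hx : x ∈ σ.diagonal e) : x = σ.toDiagonal e t₀ (σ.iso (e s₀) t₀ (x s₀)) := by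
  funext s
  rw [toDiagonal_apply, σ.iso_trans, hx s₀ s]

/-- `toDiagonal` is injective as soon as the index set is nonempty (`l⋇ ≥ 1`).
[cite: Mochizuki2012, Cor 4.5 (iii) p.133] -/
theorem toDiagonal_injective {S : Type w} [Nonempty S] (e : S → T) (t₀ : T) :
    Function.Injective (σ.toDiagonal e t₀) := by
  obtain ⟨s₀⟩ := ‹Nonempty S›
  intro a b h
  have h' := congrFun h s₀
  rw [toDiagonal_apply, toDiagonal_apply] at h'
  exact (σ.iso t₀ (e s₀)).injective h'

/-- The range of `toDiagonal` is exactly the diagonal submonoid (nonempty index set).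
[cite: Mochizuki2012, Cor 4.5 (iii) p.133] -/
theorem mrange_toDiagonal {S : Type w} [Nonempty S] (e : S → T) (t₀ : T) :
    MonoidHom.mrange (σ.toDiagonal e t₀) = σ.diagonal e := by
  obtain ⟨s₀⟩ := ‹Nonempty S›
  ext x
  constructor
  · rintro ⟨m, rfl⟩
    exact σ.toDiagonal_mem e t₀ m
  · intro hx
    exact ⟨σ.iso (e s₀) t₀ (x s₀), (σ.eq_toDiagonal_of_mem e t₀ s₀ hx).symm⟩

/-- **The identification `Ψ_{t₀} ⥲ Ψ_{⟨S⟩}`** of the copy labeled `t₀` with the diagonal submonoid over a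
nonempty set of labels `S` — [IUTchII] Cor 4.5 (iii) p. 133 l. 3–10: "an isomorphism
`Ψ_cns(†D_≻)_0 ⥲ Ψ_cns(†D_≻)_{⟨F_l^⋇⟩}` constituted by the various corresponding local isomorphisms of Corollary
3.5, (iii), and Propositions 4.1, (iii); 4.3, (iii)"; Cor 4.6 (iii) p. 138 l. 41–47
"`Ψ_cns(†F_≻)_0 ⥲ Ψ_cns(†F_≻)_{⟨F_l^⋇⟩}`" (`t₀ = 0`, `S = F_l^⋇`, `l⋇ ≥ 1`). This is the typed form of
SUBDAG-IUTchIII-Thm-15 row r6a. [cite: Mochizuki2012, Cor 4.5 (iii) p.133] -/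
noncomputable def diagonalIso {S : Type w} [Nonempty S] (e : S → T) (t₀ : T) :
    Ψ t₀ ≃* σ.diagonal e :=
  (MulEquiv.ofBijective (σ.toDiagonal e t₀).mrangeRestrict
      ⟨fun _ _ h => σ.toDiagonal_injective e t₀ (congrArg Subtype.val h),
        MonoidHom.mrangeRestrict_surjective _⟩).trans
    (MulEquiv.submonoidCongr (σ.mrange_toDiagonal e t₀))

/-- Components of the identification: the `s`-component of the image of `m ∈ Ψ_{t₀}` is `σ_{t₀,e(s)}(m)`.
[cite: Mochizuki2012, Cor 4.5 (iii) p.133] -/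
@[simp] theorem coe_diagonalIso_apply {S : Type w} [Nonempty S] (e : S → T) (t₀ : T) (m : Ψ t₀) (s : S) :
    (σ.diagonalIso e t₀ m : ∀ s : S, Ψ (e s)) s = σ.iso t₀ (e s) m := rfl

/-- The inverse identification evaluates a diagonal family at any label and transports back.
[cite: Mochizuki2012, Cor 4.5 (iii) p.133] -/
theorem diagonalIso_symm_apply {S : Type w} [Nonempty S] (e : S → T) (t₀ : T) (x : σ.diagonal e) (s : S) :
    (σ.diagonalIso e t₀).symm x = σ.iso (e s) t₀ ((x : ∀ s : S, Ψ (e s)) s) := by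
  apply (σ.diagonalIso e t₀).injective
  rw [MulEquiv.apply_symm_apply]
  apply Subtype.ext
  exact σ.eq_toDiagonal_of_mem e t₀ s x.2

/-- Restricting a diagonal family along a further re-indexing `f : S' → S` stays diagonal — the
inclusion `F_l^⋇ ↪ |F_l|` relating `Ψ_{⟨F_l^⋇⟩}` and `Ψ_{⟨|F_l|⟩}` (Cor 4.5 (iii) p. 132–133, the two displays).
[cite: Mochizuki2012, Cor 4.5 (iii) p.133] -/
theorem restrict_mem_diagonal {S : Type w} {S' : Type u'} (e : S → T) (f : S' → S) {x : ∀ s : S, Ψ (e s)}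
    (hx : x ∈ σ.diagonal e) : (fun s' => x (f s')) ∈ σ.diagonal (fun s' => e (f s')) :=
  fun s s' => hx (f s) (f s')

/-! ### Literal copies: the local kernel of Prop 4.1 (iii) / 4.3 (iii) / Cor 3.5 (i) is the special case -/

/-- The system of LITERAL copies of one monoid `M` labeled by `T`, all symmetrizing isomorphisms being the
identity (the typing of abc-iut-L6-t2's `GaussianMonoidsGood.lean`). [cite: Mochizuki2012, Prop 4.1 (iii) p.121] -/
def ofCopies (T : Type u) (M : Type v) [CommMonoid M] : SymmetrizingIsos (fun _ : T => M) where
  iso _ _ := MulEquiv.refl M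
  iso_self _ _ := rfl
  iso_trans _ _ _ _ := rfl

/-- For literal copies the diagonal of this file IS abc-iut-L6-t2's `diagonalSubmonoid` (constant families).
[cite: Mochizuki2012, Prop 4.1 (iii) p.121] -/
theorem diagonal_ofCopies (T : Type u) (M : Type v) [CommMonoid M] :
    (ofCopies T M).diagonal (fun t : T => t) = diagonalSubmonoid T M := by
  ext x
  rw [mem_diagonal_iff, mem_diagonalSubmonoid]
  exact Iff.rfl

/-! ### The `V`-indexed product: "the «⊆'s» denote the various local inclusions of diagonal submonoids" -/

section Pi

variable {V : Type u'} {T : Type u} {Φ : V → T → Type v} [∀ v t, CommMonoid (Φ v t)]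

/-- The product over `v ∈ V` of local systems of symmetrizing isomorphisms is a system of symmetrizing
isomorphisms of the `V`-indexed families `(Φ_{v,t})_v` — Cor 4.5 (iii) assembles the global symmetrizing
isomorphisms from "the various local `F_l^⋊±`-actions discussed in Corollary 3.5, (i), and Propositions 4.1,
(iii); 4.3, (iii)" (p. 132 l. 48–51). [cite: Mochizuki2012, Cor 4.5 (iii) p.132] -/
def pi (τ : ∀ v : V, SymmetrizingIsos (Φ v)) : SymmetrizingIsos (fun t : T => ∀ v : V, Φ v t) where
  iso t t' := MulEquiv.piCongrRight fun v => (τ v).iso t t'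
  iso_self t x := funext fun v => (τ v).iso_self t (x v)
  iso_trans t t' t'' x := funext fun v => (τ v).iso_trans t t' t'' (x v)

/-- A `V`-indexed family is in the global diagonal iff it is in the local diagonal at every `v` — "the
«⊆'s» denote the various local inclusions of diagonal submonoids" (Cor 4.5 (iii) p. 133 l. 2–3).
[cite: Mochizuki2012, Cor 4.5 (iii) p.133] -/
theorem mem_diagonal_pi_iff (τ : ∀ v : V, SymmetrizingIsos (Φ v)) {S : Type w} (e : S → T)
    (x : ∀ s : S, ∀ v : V, Φ v (e s)) :
    x ∈ (pi τ).diagonal e ↔ ∀ v : V, (fun s => x s v) ∈ (τ v).diagonal e := by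
  simp only [mem_diagonal_iff]
  constructor
  · intro h v s s'
    exact congrFun (h s s') v
  · intro h s s'
    exact funext fun v => h v s s'

/-- The global identification is "constituted by the various corresponding local isomorphisms": its
`v`-component is the local identification (Cor 4.5 (iii) p. 133 l. 9–10). [cite: Mochizuki2012, Cor 4.5 (iii) p.133] -/
theorem coe_diagonalIso_pi_apply (τ : ∀ v : V, SymmetrizingIsos (Φ v)) {S : Type w} [Nonempty S]
    (e : S → T) (t₀ : T) (m : ∀ v : V, Φ v t₀) (s : S) (v : V) :
    ((pi τ).diagonalIso e t₀ m : ∀ s : S, ∀ v : V, Φ v (e s)) s v = (τ v).iso t₀ (e s) (m v) := rfl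

end Pi

end SymmetrizingIsos


/-! ### From an ACTION to the system of symmetrizing isomorphisms: conjugate synchronization

[IUTchII] Cor 4.5 (iii) p. 132 l. 48–55: "the various local `F_l^⋊±`-actions … induce isomorphisms between the
labeled data `Ψ_cns(†D_≻)_t` for distinct `t ∈ LabCusp^±(†D_≻)`"; Rmk 4.5.3 (i) p. 135 l. 32–37: "the crucial
conjugate synchronization … is possible in the case of the `F_l^⋊±`-symmetry — but not in the case of the
`F_l^⋇`-symmetry! — precisely because of the connectedness, at each `v ∈ V`, of the local components involved".
At monoid level: a group `G` acting transitively on the labels `T`, together with transport isomorphisms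
`Ψ_t ⥲ Ψ_{g·t}` satisfying the cocycle condition, induces a WELL-DEFINED system of symmetrizing isomorphisms as
soon as every element of the stabilizer of a label acts trivially on the data carrying that label
(`ActionTransport.sync`): the isomorphism `Ψ_t ⥲ Ψ_{t'}` is then independent of the group element carrying `t`
to `t'` (`ActionTransport.act_eq_act`). -/

/-- Transport data for a `G`-action on labeled monoids: for `g • t = t'` an isomorphism `Ψ_t ⥲ Ψ_{t'}`
(indexed by both endpoints and the equation, so that no transport along type equalities is needed), the
identity for `g = 1`, multiplicative in `g`, and **synchronized** — a group element fixing the label `t` acts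
as the identity on `Ψ_t` ([IUTchII] Rmk 4.5.3 (i) "conjugate synchronization"; Cor 3.5 (i) p. 94: the
`F_l^⋊±`-action on `Π_X(M^Θ_*)` is a `Δ`-OUTER action, so the data `Ψ_cns(−)_t`, defined up to inner
automorphisms, are acted on trivially by label-fixing elements). [cite: Mochizuki2012, Rmk 4.5.3 (i) p.135] -/
structure ActionTransport (G : Type u') [Group G] {T : Type u} [MulAction G T] (Ψ : T → Type v)
    [∀ t, CommMonoid (Ψ t)] where
  /-- transport along `g • t = t'` -/
  act : ∀ (g : G) (t t' : T), g • t = t' → (Ψ t ≃* Ψ t')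
  /-- `g = 1` transports by the identity -/
  act_one : ∀ (t : T) (x : Ψ t), act 1 t t (one_smul G t) x = x
  /-- cocycle condition: transporting along `g` and then along `g'` is transporting along `g' * g` -/
  act_mul : ∀ (g g' : G) (t t' t'' : T) (h : g • t = t') (h' : g' • t' = t'') (x : Ψ t),
    act g' t' t'' h' (act g t t' h x) = act (g' * g) t t'' (by rw [mul_smul, h, h']) x
  /-- conjugate synchronization: the stabilizer of `t` acts trivially on `Ψ_t` -/
  sync : ∀ (g : G) (t : T) (h : g • t = t) (x : Ψ t), act g t t h x = x

namespace ActionTransport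

variable {G : Type u'} [Group G] {T : Type u} [MulAction G T] {Ψ : T → Type v} [∀ t, CommMonoid (Ψ t)]
  (A : ActionTransport G Ψ)

/-- Transport depends on the group element only through its value (proof-irrelevance bookkeeping).
[cite: Mochizuki2012, Rmk 4.5.3 (i) p.135] -/
theorem act_congr {g₁ g₂ : G} (e : g₁ = g₂) (t t' : T) (h₁ : g₁ • t = t') (h₂ : g₂ • t = t') (x : Ψ t) :
    A.act g₁ t t' h₁ x = A.act g₂ t t' h₂ x := by
  subst e
  rfl

/-- **Well-definedness from synchronization**: two group elements carrying `t` to `t'` transport identically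
(`g' = (g' g⁻¹) g` with `g' g⁻¹` in the stabilizer of `t'`). [cite: Mochizuki2012, Rmk 4.5.3 (i) p.135] -/
theorem act_eq_act (g g' : G) (t t' : T) (h : g • t = t') (h' : g' • t = t') (x : Ψ t) :
    A.act g t t' h x = A.act g' t t' h' x := by
  have hstab : (g' * g⁻¹) • t' = t' := by
    rw [mul_smul, ← h, inv_smul_smul, h']
    exact h.symm
  rw [← A.sync (g' * g⁻¹) t' hstab (A.act g t t' h x), A.act_mul]
  exact A.act_congr (inv_mul_cancel_right g' g) t t' _ h' x

/-- The system of symmetrizing isomorphisms INDUCED by a synchronized transitive action ([IUTchII] Cor 4.5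
(iii) p. 132: "the various local `F_l^⋊±`-actions … induce isomorphisms between the labeled data … for distinct
`t`"): `σ_{t,t'}` := transport along any `g` with `g • t = t'` (one exists by transitivity; the result does
not depend on it by `act_eq_act`). [cite: Mochizuki2012, Cor 4.5 (iii) p.132] -/
noncomputable def toSymmetrizingIsos [MulAction.IsPretransitive G T] : SymmetrizingIsos Ψ where
  iso t t' :=
    A.act (MulAction.exists_smul_eq G t t').choose t t' (MulAction.exists_smul_eq G t t').choose_spec
  iso_self t x := by
    rw [A.act_eq_act _ 1 t t _ (one_smul G t) x, A.act_one]
  iso_trans t t' t'' x := by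
    rw [A.act_mul]
    exact A.act_eq_act _ _ _ _ _ _ x

/-- The induced symmetrizing isomorphism `σ_{t, t'}` IS transport along any `g` with `g • t = t'`
(independent of all choices). [cite: Mochizuki2012, Cor 4.5 (iii) p.132] -/
theorem toSymmetrizingIsos_iso_apply [MulAction.IsPretransitive G T] (g : G) (t t' : T) (h : g • t = t')
    (x : Ψ t) : (A.toSymmetrizingIsos).iso t t' x = A.act g t t' h x :=
  A.act_eq_act _ _ _ _ _ _ x

end ActionTransport

end Literature.IUT.HodgeArakelov
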